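import Literature.AlgebraicGeometry.HodgeTheory.HardLefschetzProducts
import Literature.Algebra.Lie.LefschetzModuleTensor
import Literature.Algebra.Lie.LefschetzModuleWeylOperatorTensor
import Literature.Algebra.Lie.LefschetzModuleTransport
import HarnessLib

/-!
# André 1996 §1.3 on the carriers: the `𝔰𝔩₂`-operators `ᶜΛ`, `*_L`, `w`, `*_H` of `Y × Z` for the product class are the
# tensor operators, through the Künneth isomorphism (Looijenga–Lunts `M' ⊠ M''`; Kleiman's `Λ_{X×Y} = Λ_X ⊗ 1 + 1 ⊗ Λ_Y`)

Family `hodge`, lane `lit-hodgefound` (Track 2 foundations library), layer `Literature/AlgebraicGeometry/HodgeTheory`,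
namespace `Literature.AlgebraicGeometry.HodgeTheory`; prover seat `lit-hodgefound-p21` (generation 36, row g36-#2), sequel
of `HodgeTheory/HardLefschetzProducts` (g36-#1: the Künneth isomorphism `κ = kunnethEquiv` intertwines the degree operators
and the Lefschetz operators, `kunnethEquiv_conj_degreeOperator`, `kunnethEquiv_conj_totalLefschetz`, whence hard Lefschetz
for `pr_Y^* η + pr_Z^* η'`).  THEOREMS ONLY (no definition, no named fact, no instance; D-0026 net debt `0`).  The ABSTRACT
statements are the tree's (lane rows A1-90 `Algebra/Lie/LefschetzModule` §8, p34 g31-#2 `LefschetzModuleWeylOperatorTensor`,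
g31-#8 `LefschetzModuleTransport`); this file places them on `H*((Y × Z)(ℂ); ℂ)`.

## Source, VERBATIM (Y. André, *Pour une théorie inconditionnelle des motifs*, Publ. Math. IHÉS 83 (1996), §1.3 pp. 12–13
= held `paper:doi-10-1007-bf02698643` p0009 L34–L45, p0010 L5–L44)

«1.3. Nous donnons maintenant quelques sorites concernant les involutions `*_L` et `*_H` sur un produit `X × Y` de
`K`-schémas projectifs lisses, équidimensionnels de dimensions respectives `d` et `d'`.  L'isomorphisme (d'algèbres
graduées) de Künneth : `H•(X × Y) ≅ H•(X) ⊗ H•(Y)` devient un isomorphisme de `𝔰𝔩₂`-modules si l'on munit `X × Y` du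
faisceau inversible ample `𝓛_{X×Y} = p_X^* 𝓛_X ⊗ p_Y^* 𝓛_Y`.  Par le formalisme des `𝔰𝔩₂`-triplets (cf. [D80] 1.6.12.1,
avec le dictionnaire `N = ᶜΛ`, `Gr_i = H^{d-i}(X)`, `P_{-i} = P^{d-i}(X)`), on déduit de l'isomorphisme de
`𝔰𝔩₂`-représentations `Sⁱ ⊗ Sʲ ≅ ⊕ S^{i+j-2k}` (Clebsch–Gordan) un isomorphisme canonique :
`P•(X × Y) ≅ ⊕ … P•(X) ⊗ P•(Y)`; l'inclusion `P•(X) ⊗ P•(Y) ⊆ P•(X × Y)` fournie par cet isomorphisme est restriction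
de l'isomorphisme de Künneth.
**Lemme 1.3.1.** — Considérons `Pⁱ(X) ⊗ Pʲ(Y)` comme un sous-espace de `P^{i+j}(X × Y)` et `L^{d-i}Pⁱ(X) ⊗ L^{d'-j}Pʲ(Y)`
comme un sous-espace de `L^{d-i+d'-j}P^{i+j}(X × Y)`. Alors les isomorphismes `L^{d-i}Pⁱ(X) ⊗ L^{d'-j}Pʲ(Y) → Pⁱ(X) ⊗ Pʲ(Y)`
donnés par l'involution de Lefschetz (resp. Hodge) relative à `X × Y` d'une part, par `[c ·] *_{L,X} ⊗ *_{L,Y}`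
(resp. `(-1)^{ij} *_{H,X} ⊗ *_{H,Y}`) d'autre part, coïncident.
**Lemme 1.3.2.** — … Pour l'involution de Hodge, on a la formule `*_H x ⊗ *_H y = (-1)^{ij} *_H (x ⊗ y)`. … La formule
pour l'involution de Hodge découle de son interprétation en termes de l'élément `(0 1 ; -1 0)` de `SL₂`.»
S. Kleiman, *Algebraic cycles and the Weil conjectures* (1968), Thm. 2.9 proof / *The standard conjectures* (1994),
Cor. 4.?: «`Λ_{X×Y} = Λ_X ⊗ 1 + 1 ⊗ Λ_Y`» (the operator `Λ` of the product polarization) — cited through André's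
«dictionnaire `N = ᶜΛ`» and Looijenga–Lunts §1 (1.1) p. 4: «`(𝔞' × 𝔞'', M' ⊠ M'')`, `e(m' ⊗ m'') = e m' ⊗ m'' + m' ⊗ e m''`».

## Rendering (the tree's carriers)

`M_Y = totalCohomology ℂ Y(ℂ) = ⨁ₖ Hᵏ(Y(ℂ); ℂ)` with `h_Y = degreeOperator ℂ Y(ℂ) m`, `e_Y = totalLefschetz η`; the
Lefschetz structure `L_Y = hasLefschetzProperty_complexPoints hY hη : HasLefschetzProperty h_Y e_Y` of a hard-Lefschetz
class `η` in dimension `m = dim Y` (`IsZGrading h_Y`: `isZGrading_degreeOperator`); André's operators are the tree's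
ABSTRACT ones of this structure — `ᶜΛ = L_Y.dual`, `*_L = L_Y.lefschetzInvolution` (= the concrete
`totalLefschetzInvolution hη`, §2), `w = L_Y.weylOperator` (`exp ᶜΛ · exp(-L) · exp ᶜΛ`), `*_H = L_Y.andreHodgeInvolution _ m`.
On `Y × Z`: the class `θ = pr_Y^* η + pr_Z^* η'`, hard Lefschetz in dimension `m + n`
(`hasHardLefschetzProperty_map_fst_add_map_snd`), its structure `L_{Y×Z}`; the tensor structure `L_Y.tensor _ L_Z _` on
`M_Y ⊗ M_Z`; `κ = kunnethEquiv hY hZ : M_Y ⊗ M_Z ≃ₗ M_{Y×Z}`, `a ⊗ b ↦ a × b = pr_Y^* a ∪ pr_Z^* b` (`kunnethCross`).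

## WHAT IS PROVED

* §0 `depth_degreeOperator_complexPoints_le` (`depth h_Y ≤ dim Y`), `kunnethEquiv_degreeOperator_tensor`,
  `kunnethEquiv_totalLefschetz_tensor` (pointwise intertwining), `degreeOperator_tensor_ne_zero` (`h_Y ⊗ 1 + 1 ⊗ h_Z ≠ 0`
  when `dim Y + dim Z > 0`), `kunnethEquiv_conj_apply_kunnethCross` (`(κ T κ⁻¹)(a × b) = κ (T (a ⊗ b))`).
* §1 `ᶜΛ`: **`kunnethEquiv_conj_dual_tensor`** (`κ ᶜΛ_{M_Y ⊠ M_Z} κ⁻¹ = ᶜΛ_{Y×Z}`), **`dual_kunnethCross_tmul`**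
  (`ᶜΛ_{Y×Z}(a × b) = ᶜΛ_Y a × b + a × ᶜΛ_Z b`), **`isDualLefschetz_kunnethEquiv_conj`** (Kleiman: if `(L_η, h, Λ_Y)`,
  `(L_η', h, Λ_Z)` are `𝔰𝔩₂`-triples on `H*(Y)`, `H*(Z)`, then `(L_θ, h, κ(Λ_Y ⊗ 1 + 1 ⊗ Λ_Z)κ⁻¹)` is one on `H*(Y × Z)`),
  `kunnethEquiv_conj_rTensor_add_lTensor_kunnethCross` (its cross formula `Λ(a × b) = Λ_Y a × b + a × Λ_Z b`),
  `kunnethEquiv_conj_eq_dual_of_isDualLefschetz` (any such pair gives THE `ᶜΛ_{Y×Z}`), `hasDualLefschetz_map_fst_add_map_snd`.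
* §2 `*_L`: `totalLefschetzInvolution_eq_lefschetzInvolution` (the concrete `*_L` of the tree IS the abstract one of the
  Lefschetz structure — string reversal, unique), **`kunnethEquiv_conj_lefschetzInvolution_tensor`**
  (`κ *_{L, M_Y ⊠ M_Z} κ⁻¹ = *_{L, Y×Z}`), **`totalLefschetzInvolution_kunnethCross_tmul_top`** (Lemme 1.3.1, Lefschetz clause,
  with the constant COMPUTED: `*_{L,Y×Z}(Lᵃ p × L'ᵇ q) = C(a+b, a)⁻¹ · (p × q)` for primitive `p ∈ P^{m-a}(Y)`,
  `q ∈ P^{n-b}(Z)`), `ofDegree_mem_primitiveSpace_iff` (dictionary `P_{-a} = P^{m-a}`).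
* §3 `w`, `*_H`: **`kunnethEquiv_conj_weylOperator_tensor`**, **`weylOperator_kunnethCross_tmul`** (`w_{Y×Z}(a × b) =
  w_Y a × w_Z b` — «son interprétation en termes de l'élément `(0 1 ; -1 0)` de `SL₂`»),
  **`kunnethEquiv_conj_andreHodgeInvolution_tensor`**, **`andreHodgeInvolution_kunnethCross`** (Lemme 1.3.2, Hodge clause, ON THE
  CARRIERS: `*_{H,Y×Z}(a × b) = (-1)^{ij} · *_{H,Y} a × *_{H,Z} b` for `a ∈ Hⁱ(Y(ℂ))`, `b ∈ Hʲ(Z(ℂ))`), and the printed form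
  `andreHodgeInvolution_kunnethCross_symm` (`*_H a × *_H b = (-1)^{ij} *_H (a × b)`).

## SCOPE / NOT HERE

The `*_L`-clause of Lemme 1.3.2 (the universal rationals `r`), the Clebsch–Gordan isomorphism `P(X × Y) ≅ ⊕ P(X) ⊗ P(Y)`
itself, and [D80] 1.6.12.1 are not formalized (neither abstractly in the tree); `m + n > 0` is assumed where Mathlib's
convention `h ≠ 0` for `𝔰𝔩₂`-triples enters (`dual_tensor`, `weylOperator_tensor`).

## References

* [Andre1996Motifs] Y. André, Publ. Math. IHÉS 83 (1996), §1.1 (p. 10), §1.2 (p. 11), §1.3 Lemme 1.3.1–1.3.2 (pp. 12–13).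
* [LooijengaLunts1997] E. Looijenga, V. A. Lunts, Invent. Math. 129 (1997), §1 (1.1) p. 4 (`M' ⊠ M''`, uniqueness of `f`).
* [Kleiman1968AlgebraicCycles] S. Kleiman, *Algebraic cycles and the Weil conjectures* (1968), §1.4 (1.4.6), Thm. 2.9.
* [HatcherAT2002] A. Hatcher, *Algebraic Topology* (2002), §3.2 Thm. 3.16.
-/

noncomputable section

open CategoryTheory MonoidalCategory CartesianMonoidalCategory
open scoped TensorProduct
open Literature.AlgebraicTopology.SingularHomology
open Literature.AlgebraicGeometry.Motives
open Literature.AlgebraicGeometry.Hyperkaehler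
open Literature.Geometry.Kaehler
open Literature.Algebra.Lie
open Literature.Algebra.Lie.HasLefschetzProperty (primitiveSpace mem_primitiveSpace_iff)

namespace Literature.AlgebraicGeometry.HodgeTheory

variable {m n : ℕ} {Y Z : SchemeOver ℂ}

/-! ### §0 The dictionary: depth, intertwining, `h ⊗ 1 + 1 ⊗ h' ≠ 0` -/

section Dictionary

/-- **`depth (H*(Y(ℂ); ℂ), h_m) ≤ m`** for `Y` smooth projective of dimension `m`: the degree part `M_k = H^{m+k}`
vanishes for `k > m`. [cite: LooijengaLunts1997, §1 (1.1) p. 4 L58–L60 (depth) and (1.9) p. 6 ("M = H(X)[n]")]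
[cite: HatcherAT2002, §3.3 Thm. 3.26(c)] -/
theorem depth_degreeOperator_complexPoints_le (hY : IsSmoothProjective m Y) :
    depth (degreeOperator ℂ (ComplexPoints Y) m) ≤ m := by
  refine csSup_le' fun k hk ↦ ?_
  by_contra hlt
  refine hk ?_
  rw [degreeSpace_degreeOperator_eq_range m (m + k) (by push_cast; ring), LinearMap.range_eq_bot]
  ext x
  rw [complexBetti_eq_zero_of_lt hY (m + k) (by push Not at hlt; omega) x, map_zero, LinearMap.zero_apply]

/-- **`κ (h_Y ⊗ 1 + 1 ⊗ h_Z) = h_{Y×Z} κ`** pointwise. [cite: Andre1996Motifs, §1.3 (p. 12)] [cite: LooijengaLunts1997, §1 (1.1) p. 4 L72–L82] -/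
theorem kunnethEquiv_degreeOperator_tensor (hY : IsSmoothProjective m Y) (hZ : IsSmoothProjective n Z)
    (x : totalCohomology ℂ (ComplexPoints Y) ⊗[ℂ] totalCohomology ℂ (ComplexPoints Z)) :
    kunnethEquiv hY hZ (((degreeOperator ℂ (ComplexPoints Y) m).rTensor (totalCohomology ℂ (ComplexPoints Z)) +
        (degreeOperator ℂ (ComplexPoints Z) n).lTensor (totalCohomology ℂ (ComplexPoints Y))) x) =
      degreeOperator ℂ (ComplexPoints (Y ⊗ Z)) (m + n) (kunnethEquiv hY hZ x) := by
  rw [kunnethEquiv_apply, kunnethEquiv_apply, degreeOperator_totalCross]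

/-- **`κ (L_η ⊗ 1 + 1 ⊗ L_η') = L_{pr_Y^* η + pr_Z^* η'} κ`** pointwise. [cite: Andre1996Motifs, §1.3 (p. 12)]
[cite: LooijengaLunts1997, §1 (1.1) p. 4 L72–L82] -/
theorem kunnethEquiv_totalLefschetz_tensor (hY : IsSmoothProjective m Y) (hZ : IsSmoothProjective n Z)
    (η : complexBetti Y 2) (η' : complexBetti Z 2)
    (x : totalCohomology ℂ (ComplexPoints Y) ⊗[ℂ] totalCohomology ℂ (ComplexPoints Z)) :
    kunnethEquiv hY hZ (((totalLefschetz η).rTensor (totalCohomology ℂ (ComplexPoints Z)) +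
        (totalLefschetz η').lTensor (totalCohomology ℂ (ComplexPoints Y))) x) =
      totalLefschetz (complexBetti.map (fst Y Z) 2 η + complexBetti.map (snd Y Z) 2 η') (kunnethEquiv hY hZ x) := by
  rw [kunnethEquiv_apply, kunnethEquiv_apply, totalLefschetz_totalCross]

/-- **The total degree operator `h_Y ⊗ 1 + 1 ⊗ h_Z` is non-zero** as soon as `dim Y + dim Z > 0` (it is conjugate to
`h_{Y×Z}`, non-zero on `H⁰ ≠ 0`; Mathlib's convention `h ≠ 0` for `𝔰𝔩₂`-triples). [cite: LooijengaLunts1997, §1 (1.1) p. 4 L88 ("if both factors are nonzero")] -/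
theorem degreeOperator_tensor_ne_zero (hY : IsSmoothProjective m Y) (hZ : IsSmoothProjective n Z) (hmn : 0 < m + n) :
    (degreeOperator ℂ (ComplexPoints Y) m).rTensor (totalCohomology ℂ (ComplexPoints Z)) +
        (degreeOperator ℂ (ComplexPoints Z) n).lTensor (totalCohomology ℂ (ComplexPoints Y)) ≠ 0 := by
  intro h0
  have h1 := kunnethEquiv_conj_degreeOperator hY hZ
  rw [h0, map_zero] at h1
  exact degreeOperator_complexPoints_ne_zero (IsSmoothProjective.tensor_holds hY hZ) hmn h1.symm

/-- `(κ T κ⁻¹)(κ x) = κ (T x)` (plumbing). [folklore] -/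
private theorem kunnethEquiv_conj_apply_kunnethEquiv (hY : IsSmoothProjective m Y) (hZ : IsSmoothProjective n Z)
    (T : Module.End ℂ (totalCohomology ℂ (ComplexPoints Y) ⊗[ℂ] totalCohomology ℂ (ComplexPoints Z)))
    (x : totalCohomology ℂ (ComplexPoints Y) ⊗[ℂ] totalCohomology ℂ (ComplexPoints Z)) :
    (kunnethEquiv hY hZ).conj T (kunnethEquiv hY hZ x) = kunnethEquiv hY hZ (T x) := by
  rw [LinearEquiv.conj_apply_apply, LinearEquiv.symm_apply_apply]

/-- `(κ T κ⁻¹)(a × b) = κ (T (a ⊗ b))` on cross products. [cite: HatcherAT2002, §3.2 Thm. 3.16] -/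
theorem kunnethEquiv_conj_apply_kunnethCross (hY : IsSmoothProjective m Y) (hZ : IsSmoothProjective n Z)
    (T : Module.End ℂ (totalCohomology ℂ (ComplexPoints Y) ⊗[ℂ] totalCohomology ℂ (ComplexPoints Z)))
    (a : totalCohomology ℂ (ComplexPoints Y)) (b : totalCohomology ℂ (ComplexPoints Z)) :
    (kunnethEquiv hY hZ).conj T (kunnethCross Y Z (a ⊗ₜ b)) = kunnethCross Y Z (T (a ⊗ₜ b)) := by
  rw [← kunnethEquiv_apply hY hZ, kunnethEquiv_conj_apply_kunnethEquiv, kunnethEquiv_apply]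

end Dictionary

/-! ### §1 The dual Lefschetz operator `ᶜΛ` of `Y × Z`: `ᶜΛ_{Y×Z} = κ (ᶜΛ_Y ⊗ 1 + 1 ⊗ ᶜΛ_Z) κ⁻¹` -/

section Dual

variable (hY : IsSmoothProjective m Y) (hZ : IsSmoothProjective n Z) {η : complexBetti Y 2} {η' : complexBetti Z 2}
  (hη : HasHardLefschetzProperty η m) (hη' : HasHardLefschetzProperty η' n)

/-- **`κ ᶜΛ_{M_Y ⊠ M_Z} κ⁻¹ = ᶜΛ_{Y×Z}`**: the Künneth isomorphism carries the `𝔰𝔩₂`-partner of the tensor Lefschetz structure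
to André's `ᶜΛ` of `Y × Z` for the class `pr_Y^* η + pr_Z^* η'` (uniqueness of `f`, transported: the tree's
`HasLefschetzProperty.conj_dual_eq`). [cite: Andre1996Motifs, §1.3 (p. 12, "dictionnaire N = ᶜΛ")]
[cite: LooijengaLunts1997, §1 (1.1) p. 4 L4 ("This f is then unique") and L72–L82] -/
theorem kunnethEquiv_conj_dual_tensor :
    haveI := finite_totalCohomology hY
    haveI := finite_totalCohomology hZ
    (kunnethEquiv hY hZ).conj
        (((hasLefschetzProperty_complexPoints hY hη).tensor (isZGrading_degreeOperator m)
            (hasLefschetzProperty_complexPoints hZ hη') (isZGrading_degreeOperator n)).dual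
          (isZGrading_rTensor_add_lTensor (isZGrading_degreeOperator m) (isZGrading_degreeOperator n))) =
      (hasLefschetzProperty_complexPoints (IsSmoothProjective.tensor_holds hY hZ)
          (hasHardLefschetzProperty_map_fst_add_map_snd hY hZ hη hη')).dual (isZGrading_degreeOperator (m + n)) := by
  haveI := finite_totalCohomology hY
  haveI := finite_totalCohomology hZ
  haveI := finite_totalCohomology (IsSmoothProjective.tensor_holds hY hZ)
  exact HasLefschetzProperty.conj_dual_eq _ _ _ _ (kunnethEquiv hY hZ)
    (fun x ↦ kunnethEquiv_degreeOperator_tensor hY hZ x) (fun x ↦ kunnethEquiv_totalLefschetz_tensor hY hZ η η' x)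

/-- **Kleiman's `Λ_{X×Y} = Λ_X ⊗ 1 + 1 ⊗ Λ_Y` on the carriers: `ᶜΛ_{Y×Z}(a × b) = ᶜΛ_Y a × b + a × ᶜΛ_Z b`** (for
`dim Y + dim Z > 0`; `ᶜΛ_{M_Y ⊠ M_Z} = ᶜΛ_Y ⊗ 1 + 1 ⊗ ᶜΛ_Z`, `HasLefschetzProperty.dual_tensor`, through `κ`).
[cite: Andre1996Motifs, §1.3 (p. 12)] [cite: Kleiman1968AlgebraicCycles, Thm. 2.9 (proof)] [cite: LooijengaLunts1997, §1 (1.1) p. 4 L72–L82] -/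
theorem dual_kunnethCross_tmul (hmn : 0 < m + n) (a : totalCohomology ℂ (ComplexPoints Y))
    (b : totalCohomology ℂ (ComplexPoints Z)) :
    haveI := finite_totalCohomology hY
    haveI := finite_totalCohomology hZ
    haveI := finite_totalCohomology (IsSmoothProjective.tensor_holds hY hZ)
    (hasLefschetzProperty_complexPoints (IsSmoothProjective.tensor_holds hY hZ)
          (hasHardLefschetzProperty_map_fst_add_map_snd hY hZ hη hη')).dual (isZGrading_degreeOperator (m + n))
        (kunnethCross Y Z (a ⊗ₜ b)) =
      kunnethCross Y Z ((hasLefschetzProperty_complexPoints hY hη).dual (isZGrading_degreeOperator m) a ⊗ₜ b) +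
        kunnethCross Y Z (a ⊗ₜ (hasLefschetzProperty_complexPoints hZ hη').dual (isZGrading_degreeOperator n) b) := by
  haveI := finite_totalCohomology hY
  haveI := finite_totalCohomology hZ
  haveI := finite_totalCohomology (IsSmoothProjective.tensor_holds hY hZ)
  rw [← kunnethEquiv_conj_dual_tensor hY hZ hη hη', kunnethEquiv_conj_apply_kunnethCross,
    HasLefschetzProperty.dual_tensor _ _ _ _ (degreeOperator_tensor_ne_zero hY hZ hmn), rTensor_add_lTensor_tmul, map_add]

/-- **`𝔰𝔩₂`-triples multiply under `×` (Kleiman; André's «l'isomorphisme de Künneth devient un isomorphisme de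
`𝔰𝔩₂`-modules»)**: if `Λ_Y`, `Λ_Z` are dual Lefschetz operators of `η`, `η'` in dimensions `m`, `n` (`IsDualLefschetz`:
`(L_η, h_m, Λ_Y)` is an `𝔰𝔩₂`-triple on `H*(Y(ℂ); ℂ)`), then `κ (Λ_Y ⊗ 1 + 1 ⊗ Λ_Z) κ⁻¹` is a dual Lefschetz operator of
`pr_Y^* η + pr_Z^* η'` in dimension `m + n`. [cite: Andre1996Motifs, §1.3 (p. 12)] [cite: Kleiman1968AlgebraicCycles, Thm. 2.9 (proof)]
[cite: LooijengaLunts1997, §1 (1.1) p. 4 L72–L82] -/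
theorem isDualLefschetz_kunnethEquiv_conj {ΛY : Module.End ℂ (totalCohomology ℂ (ComplexPoints Y))}
    {ΛZ : Module.End ℂ (totalCohomology ℂ (ComplexPoints Z))} (hΛY : IsDualLefschetz m η ΛY)
    (hΛZ : IsDualLefschetz n η' ΛZ) :
    IsDualLefschetz (m + n) (complexBetti.map (fst Y Z) 2 η + complexBetti.map (snd Y Z) 2 η')
      ((kunnethEquiv hY hZ).conj (ΛY.rTensor (totalCohomology ℂ (ComplexPoints Z)) +
        ΛZ.lTensor (totalCohomology ℂ (ComplexPoints Y)))) := by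
  -- `H*(Z(ℂ))` is non-trivial: it carries the non-zero endomorphism `h_Z` (no commutator bracket is evaluated here, so the
  -- file needs no local `LieRing.ofAssociativeRing` instance: `isDualLefschetz_iff` unpacks the `𝔰𝔩₂`-triple)
  haveI : Nontrivial (totalCohomology ℂ (ComplexPoints Z)) := by
    by_contra hnt
    rw [not_nontrivial_iff_subsingleton] at hnt
    exact ((isDualLefschetz_iff n η' ΛZ).1 hΛZ).1 (LinearMap.ext fun x ↦ Subsingleton.elim _ _)
  have h0 := rTensor_add_lTensor_ne_zero (N := totalCohomology ℂ (ComplexPoints Z)) hΛY (isZGrading_degreeOperator n)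
  have t := isSl2Triple_rTensor_add_lTensor hΛY hΛZ h0
  rw [IsDualLefschetz, ← kunnethEquiv_conj_degreeOperator hY hZ, ← kunnethEquiv_conj_totalLefschetz hY hZ η η']
  exact (isSl2Triple_conj_iff' (kunnethEquiv hY hZ)).2 t

/-- The cross formula of that operator: `(κ (Λ_Y ⊗ 1 + 1 ⊗ Λ_Z) κ⁻¹)(a × b) = Λ_Y a × b + a × Λ_Z b`.
[cite: Kleiman1968AlgebraicCycles, Thm. 2.9 (proof)] [cite: Andre1996Motifs, §1.3 (p. 12)] -/
theorem kunnethEquiv_conj_rTensor_add_lTensor_kunnethCross (ΛY : Module.End ℂ (totalCohomology ℂ (ComplexPoints Y)))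
    (ΛZ : Module.End ℂ (totalCohomology ℂ (ComplexPoints Z))) (a : totalCohomology ℂ (ComplexPoints Y))
    (b : totalCohomology ℂ (ComplexPoints Z)) :
    (kunnethEquiv hY hZ).conj (ΛY.rTensor (totalCohomology ℂ (ComplexPoints Z)) +
        ΛZ.lTensor (totalCohomology ℂ (ComplexPoints Y))) (kunnethCross Y Z (a ⊗ₜ b)) =
      kunnethCross Y Z (ΛY a ⊗ₜ b) + kunnethCross Y Z (a ⊗ₜ ΛZ b) := by
  rw [kunnethEquiv_conj_apply_kunnethCross, rTensor_add_lTensor_tmul, map_add]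

/-- **Every pair of dual Lefschetz operators of the factors yields THE `ᶜΛ` of the product**: for `dim Y + dim Z > 0`,
`κ (Λ_Y ⊗ 1 + 1 ⊗ Λ_Z) κ⁻¹ = ᶜΛ_{Y×Z}` (uniqueness of the `𝔰𝔩₂`-partner, `IsDualLefschetz.eq_dual`).
[cite: LooijengaLunts1997, §1 (1.1) p. 4 L4] [cite: Andre1996Motifs, §1.3 (p. 12)] -/
theorem kunnethEquiv_conj_eq_dual_of_isDualLefschetz {ΛY : Module.End ℂ (totalCohomology ℂ (ComplexPoints Y))}
    {ΛZ : Module.End ℂ (totalCohomology ℂ (ComplexPoints Z))} (hΛY : IsDualLefschetz m η ΛY)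
    (hΛZ : IsDualLefschetz n η' ΛZ) :
    haveI := finite_totalCohomology (IsSmoothProjective.tensor_holds hY hZ)
    (kunnethEquiv hY hZ).conj (ΛY.rTensor (totalCohomology ℂ (ComplexPoints Z)) +
        ΛZ.lTensor (totalCohomology ℂ (ComplexPoints Y))) =
      (hasLefschetzProperty_complexPoints (IsSmoothProjective.tensor_holds hY hZ)
          (hasHardLefschetzProperty_map_fst_add_map_snd hY hZ hη hη')).dual (isZGrading_degreeOperator (m + n)) := by
  haveI := finite_totalCohomology (IsSmoothProjective.tensor_holds hY hZ)
  exact HasLefschetzProperty.eq_dual_of_isSl2Triple _ _ (isDualLefschetz_kunnethEquiv_conj hY hZ hΛY hΛZ)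

include hY hZ in
/-- **Dual Lefschetz operators exist for the product class when they exist for the factors** (`HasDualLefschetz` is
stable under `×`). [cite: Kleiman1968AlgebraicCycles, Thm. 2.9 (proof)] [cite: Andre1996Motifs, §1.3 (p. 12)] -/
theorem hasDualLefschetz_map_fst_add_map_snd (h₁ : HasDualLefschetz m η) (h₂ : HasDualLefschetz n η') :
    HasDualLefschetz (m + n) (complexBetti.map (fst Y Z) 2 η + complexBetti.map (snd Y Z) 2 η') := by
  obtain ⟨ΛY, hΛY⟩ := h₁
  obtain ⟨ΛZ, hΛZ⟩ := h₂
  exact ⟨_, isDualLefschetz_kunnethEquiv_conj hY hZ hΛY hΛZ⟩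

end Dual

/-! ### §2 The Lefschetz involution `*_L` of `Y × Z` (Lemme 1.3.1, Lefschetz clause) -/

section LefschetzInvolution

variable {d : ℕ} {X : SchemeOver ℂ}

/-- **The tree's concrete `*_L` (`totalLefschetzInvolution`: degreewise the Lefschetz isomorphism or its inverse) IS the
abstract Lefschetz involution of the Lefschetz structure `(H*(X(ℂ); ℂ), h_d, L_η)`** (both reverse the `𝔰𝔩₂`-strings,
`isStringReversal_totalLefschetzInvolution`, and a string reversal is unique, `IsStringReversal.eq_lefschetzInvolution`).
[cite: Andre1996Motifs, §1.1 (p. 10, the displayed formula for *_L)] -/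
theorem totalLefschetzInvolution_eq_lefschetzInvolution (hX : IsSmoothProjective d X) {η : complexBetti X 2}
    (hL : HasHardLefschetzProperty η d) :
    haveI := finite_totalCohomology hX
    totalLefschetzInvolution hL =
      (hasLefschetzProperty_complexPoints hX hL).lefschetzInvolution (isZGrading_degreeOperator d) := by
  haveI := finite_totalCohomology hX
  exact (isStringReversal_totalLefschetzInvolution hL (hasLefschetzProperty_complexPoints hX hL)).eq_lefschetzInvolution _ _

variable (hY : IsSmoothProjective m Y) (hZ : IsSmoothProjective n Z) {η : complexBetti Y 2} {η' : complexBetti Z 2}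
  (hη : HasHardLefschetzProperty η m) (hη' : HasHardLefschetzProperty η' n)

/-- **`κ *_{L, M_Y ⊠ M_Z} κ⁻¹ = *_{L, Y×Z}`**: the Künneth isomorphism carries the Lefschetz involution of the tensor structure
to the Lefschetz involution of `Y × Z` for `pr_Y^* η + pr_Z^* η'` (`HasLefschetzProperty.conj_lefschetzInvolution_eq`).
[cite: Andre1996Motifs, §1.3 Lemme 1.3.1 (p. 13)] -/
theorem kunnethEquiv_conj_lefschetzInvolution_tensor :
    haveI := finite_totalCohomology hY
    haveI := finite_totalCohomology hZ
    (kunnethEquiv hY hZ).conj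
        (((hasLefschetzProperty_complexPoints hY hη).tensor (isZGrading_degreeOperator m)
            (hasLefschetzProperty_complexPoints hZ hη') (isZGrading_degreeOperator n)).lefschetzInvolution
          (isZGrading_rTensor_add_lTensor (isZGrading_degreeOperator m) (isZGrading_degreeOperator n))) =
      totalLefschetzInvolution (hasHardLefschetzProperty_map_fst_add_map_snd hY hZ hη hη') := by
  haveI := finite_totalCohomology hY
  haveI := finite_totalCohomology hZ
  haveI := finite_totalCohomology (IsSmoothProjective.tensor_holds hY hZ)
  rw [totalLefschetzInvolution_eq_lefschetzInvolution (IsSmoothProjective.tensor_holds hY hZ)]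
  exact HasLefschetzProperty.conj_lefschetzInvolution_eq _ _ _ _ (kunnethEquiv hY hZ)
    (fun x ↦ kunnethEquiv_degreeOperator_tensor hY hZ x) (fun x ↦ kunnethEquiv_totalLefschetz_tensor hY hZ η η' x)

/-- **Dictionary `P_{-a}(M_Y) ∩ Hⁱ = Pⁱ(Y)`, `i + a = m`**: a homogeneous class `p ∈ Hⁱ(Y(ℂ); ℂ)` placed in `H*` lies in the
abstract primitive part `P_{-a} = M_{-a} ∩ ker L^{a+1}` iff `L^{a+1} p = 0`, i.e. `p ∈ Pⁱ = ker (L^{m-i+1} : Hⁱ → H^{2m-i+2})`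
(the tree's `lefschetzPrimitive`). [cite: Andre1996Motifs, §1.1 (p. 10, "Pⁱ(X) = Hⁱ(X) ∩ Ker L^{d-i+1}") and §1.3 (p. 12, "P_{-i} = P^{d-i}(X)")] -/
theorem ofDegree_mem_primitiveSpace_iff {i a : ℕ} (hia : i + a = m) (η : complexBetti Y 2) (p : complexBetti Y i) :
    ofDegree ℂ (ComplexPoints Y) i p ∈ primitiveSpace (degreeOperator ℂ (ComplexPoints Y) m) (totalLefschetz η) a ↔
      p ∈ lefschetzPrimitive η (show i + (a + 1) = m + 1 by omega) := by
  rw [mem_primitiveSpace_iff, mem_lefschetzPrimitive, pow_totalLefschetz_ofDegree]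
  constructor
  · rintro ⟨-, h0⟩
    exact DirectSum.of_injective (β := fun k ↦ complexBetti Y k) _ (by rw [← DirectSum.lof_eq_of ℂ]; rw [h0, map_zero])
  · intro h0
    refine ⟨ofDegree_mem_degreeSpace m i (by omega) p, ?_⟩
    rw [h0, map_zero]

/-- **Lemme 1.3.1, Lefschetz clause, on the carriers, with the constant computed**: for primitive classes
`p ∈ Pⁱ(Y)` (`i + a = m`) and `q ∈ Pʲ(Z)` (`j + b = n`), the Lefschetz involution of `Y × Z` (for `pr_Y^* η + pr_Z^* η'`)
maps the top of the product string, `Lᵃ p × L'ᵇ q ∈ H^{2m-i+2n-j}`, to `C(a+b, a)⁻¹ · (p × q) ∈ H^{i+j}` — André's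
«`*_{L,X×Y}` coïncide avec `c · *_{L,X} ⊗ *_{L,Y}` sur `L^{d-i}Pⁱ(X) ⊗ L^{d'-j}Pʲ(Y)`», `*_{L,X}(L^{d-i} p) = p`, with
`c = ((d-i)!(d'-j)!)/(d-i+d'-j)!` (the scan's unreadable constant, computed abstractly in
`lefschetzInvolution_tensor_apply_top'`). Stated on `H*((Y × Z)(ℂ); ℂ)`. [cite: Andre1996Motifs, §1.3 Lemme 1.3.1 (p. 13)] -/
theorem totalLefschetzInvolution_kunnethCross_tmul_top {i a j b : ℕ} (hia : i + a = m) (hjb : j + b = n)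
    {p : complexBetti Y i} (hp : p ∈ lefschetzPrimitive η (show i + (a + 1) = m + 1 by omega))
    {q : complexBetti Z j} (hq : q ∈ lefschetzPrimitive η' (show j + (b + 1) = n + 1 by omega)) :
    totalLefschetzInvolution (hasHardLefschetzProperty_map_fst_add_map_snd hY hZ hη hη')
        (kunnethCross Y Z (ofDegree ℂ (ComplexPoints Y) (i + 2 * a) (lefschetzPow η a i p) ⊗ₜ
          ofDegree ℂ (ComplexPoints Z) (j + 2 * b) (lefschetzPow η' b j q))) =
      (((a + b).choose a : ℕ) : ℂ)⁻¹ • kunnethCross Y Z (ofDegree ℂ (ComplexPoints Y) i p ⊗ₜ ofDegree ℂ (ComplexPoints Z) j q) := by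
  haveI := finite_totalCohomology hY
  haveI := finite_totalCohomology hZ
  have hp' := (ofDegree_mem_primitiveSpace_iff hia η p).2 hp
  have hq' := (ofDegree_mem_primitiveSpace_iff hjb η' q).2 hq
  rw [← kunnethEquiv_conj_lefschetzInvolution_tensor hY hZ hη hη', kunnethEquiv_conj_apply_kunnethCross,
    ← pow_totalLefschetz_ofDegree, ← pow_totalLefschetz_ofDegree,
    HasLefschetzProperty.lefschetzInvolution_tensor_apply_top' (hasLefschetzProperty_complexPoints hY hη)
      (isZGrading_degreeOperator m) (hasLefschetzProperty_complexPoints hZ hη') (isZGrading_degreeOperator n) hp' hq',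
    map_smul]

end LefschetzInvolution

/-! ### §3 The Weyl operator `w` and the Hodge involution `*_H` of `Y × Z` (Lemme 1.3.2, Hodge clause) -/

section Hodge

variable (hY : IsSmoothProjective m Y) (hZ : IsSmoothProjective n Z) {η : complexBetti Y 2} {η' : complexBetti Z 2}
  (hη : HasHardLefschetzProperty η m) (hη' : HasHardLefschetzProperty η' n)

/-- **`κ w_{M_Y ⊠ M_Z} κ⁻¹ = w_{Y×Z}`** (`HasLefschetzProperty.conj_weylOperator_eq`). [cite: Andre1996Motifs, §1.2 (p. 11) and §1.3 (pp. 12–13)] -/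
theorem kunnethEquiv_conj_weylOperator_tensor :
    haveI := finite_totalCohomology hY
    haveI := finite_totalCohomology hZ
    haveI := finite_totalCohomology (IsSmoothProjective.tensor_holds hY hZ)
    (kunnethEquiv hY hZ).conj
        (((hasLefschetzProperty_complexPoints hY hη).tensor (isZGrading_degreeOperator m)
            (hasLefschetzProperty_complexPoints hZ hη') (isZGrading_degreeOperator n)).weylOperator
          (isZGrading_rTensor_add_lTensor (isZGrading_degreeOperator m) (isZGrading_degreeOperator n))) =
      (hasLefschetzProperty_complexPoints (IsSmoothProjective.tensor_holds hY hZ)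
          (hasHardLefschetzProperty_map_fst_add_map_snd hY hZ hη hη')).weylOperator (isZGrading_degreeOperator (m + n)) := by
  haveI := finite_totalCohomology hY
  haveI := finite_totalCohomology hZ
  haveI := finite_totalCohomology (IsSmoothProjective.tensor_holds hY hZ)
  exact HasLefschetzProperty.conj_weylOperator_eq _ _ _ _ (kunnethEquiv hY hZ)
    (fun x ↦ kunnethEquiv_degreeOperator_tensor hY hZ x) (fun x ↦ kunnethEquiv_totalLefschetz_tensor hY hZ η η' x)

/-- **`w_{Y×Z}(a × b) = w_Y a × w_Z b`** for `dim Y + dim Z > 0`: the Weyl operator `w = exp ᶜΛ · exp(-L) · exp ᶜΛ` is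
group-like (`weylOperator_tensor`, «son interprétation en termes de l'élément `(0 1 ; -1 0)` de `SL₂`»), through `κ`.
[cite: Andre1996Motifs, §1.3 Lemme 1.3.2 (p. 13, last sentence of the proof)] -/
theorem weylOperator_kunnethCross_tmul (hmn : 0 < m + n) (a : totalCohomology ℂ (ComplexPoints Y))
    (b : totalCohomology ℂ (ComplexPoints Z)) :
    haveI := finite_totalCohomology hY
    haveI := finite_totalCohomology hZ
    haveI := finite_totalCohomology (IsSmoothProjective.tensor_holds hY hZ)
    (hasLefschetzProperty_complexPoints (IsSmoothProjective.tensor_holds hY hZ)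
          (hasHardLefschetzProperty_map_fst_add_map_snd hY hZ hη hη')).weylOperator (isZGrading_degreeOperator (m + n))
        (kunnethCross Y Z (a ⊗ₜ b)) =
      kunnethCross Y Z ((hasLefschetzProperty_complexPoints hY hη).weylOperator (isZGrading_degreeOperator m) a ⊗ₜ
        (hasLefschetzProperty_complexPoints hZ hη').weylOperator (isZGrading_degreeOperator n) b) := by
  haveI := finite_totalCohomology hY
  haveI := finite_totalCohomology hZ
  haveI := finite_totalCohomology (IsSmoothProjective.tensor_holds hY hZ)
  rw [← kunnethEquiv_conj_weylOperator_tensor hY hZ hη hη', kunnethEquiv_conj_apply_kunnethCross,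
    HasLefschetzProperty.weylOperator_tensor_tmul _ _ _ _ (degreeOperator_tensor_ne_zero hY hZ hmn)]

/-- **`κ *_{H, M_Y ⊠ M_Z} κ⁻¹ = *_{H, Y×Z}`** (same `d = m + n`; `HasLefschetzProperty.conj_andreHodgeInvolution_eq`).
[cite: Andre1996Motifs, §1.1 (p. 10) and §1.3 (pp. 12–13)] -/
theorem kunnethEquiv_conj_andreHodgeInvolution_tensor :
    haveI := finite_totalCohomology hY
    haveI := finite_totalCohomology hZ
    haveI := finite_totalCohomology (IsSmoothProjective.tensor_holds hY hZ)
    (kunnethEquiv hY hZ).conj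
        (((hasLefschetzProperty_complexPoints hY hη).tensor (isZGrading_degreeOperator m)
            (hasLefschetzProperty_complexPoints hZ hη') (isZGrading_degreeOperator n)).andreHodgeInvolution
          (isZGrading_rTensor_add_lTensor (isZGrading_degreeOperator m) (isZGrading_degreeOperator n)) (m + n)) =
      (hasLefschetzProperty_complexPoints (IsSmoothProjective.tensor_holds hY hZ)
          (hasHardLefschetzProperty_map_fst_add_map_snd hY hZ hη hη')).andreHodgeInvolution
        (isZGrading_degreeOperator (m + n)) (m + n) := by
  haveI := finite_totalCohomology hY
  haveI := finite_totalCohomology hZ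
  haveI := finite_totalCohomology (IsSmoothProjective.tensor_holds hY hZ)
  exact HasLefschetzProperty.conj_andreHodgeInvolution_eq _ _ _ _ (kunnethEquiv hY hZ)
    (fun x ↦ kunnethEquiv_degreeOperator_tensor hY hZ x) (fun x ↦ kunnethEquiv_totalLefschetz_tensor hY hZ η η' x) (m + n)

/-- **Lemme 1.3.2, Hodge clause, ON THE CARRIERS: `*_{H,Y×Z}(a × b) = (-1)^{ij} · *_{H,Y} a × *_{H,Z} b`** for
`a ∈ Hⁱ(Y(ℂ); ℂ)`, `b ∈ Hʲ(Z(ℂ); ℂ)`, `Y`, `Z` smooth projective of dimensions `m`, `n` with `m + n > 0`, and the Hodge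
involutions of the hard-Lefschetz classes `η`, `η'`, `pr_Y^* η + pr_Z^* η'` (the abstract `andreHodgeInvolution_tensor_tmul`
through `κ`; degrees: `a` lies in `M_{i-m}`, `depth h_Y ≤ m`). [cite: Andre1996Motifs, §1.3 Lemme 1.3.2 (p. 13, "*_H x ⊗ *_H y = (-1)^{ij} *_H (x ⊗ y)")] -/
theorem andreHodgeInvolution_kunnethCross (hmn : 0 < m + n) {i j : ℕ} (a : complexBetti Y i) (b : complexBetti Z j) :
    haveI := finite_totalCohomology hY
    haveI := finite_totalCohomology hZ
    haveI := finite_totalCohomology (IsSmoothProjective.tensor_holds hY hZ)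
    (hasLefschetzProperty_complexPoints (IsSmoothProjective.tensor_holds hY hZ)
          (hasHardLefschetzProperty_map_fst_add_map_snd hY hZ hη hη')).andreHodgeInvolution
          (isZGrading_degreeOperator (m + n)) (m + n)
        (kunnethCross Y Z (ofDegree ℂ (ComplexPoints Y) i a ⊗ₜ ofDegree ℂ (ComplexPoints Z) j b)) =
      ((-1 : ℂ) ^ (i * j)) •
        kunnethCross Y Z
          ((hasLefschetzProperty_complexPoints hY hη).andreHodgeInvolution (isZGrading_degreeOperator m) m
              (ofDegree ℂ (ComplexPoints Y) i a) ⊗ₜ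
            (hasLefschetzProperty_complexPoints hZ hη').andreHodgeInvolution (isZGrading_degreeOperator n) n
              (ofDegree ℂ (ComplexPoints Z) j b)) := by
  haveI := finite_totalCohomology hY
  haveI := finite_totalCohomology hZ
  haveI := finite_totalCohomology (IsSmoothProjective.tensor_holds hY hZ)
  rw [← kunnethEquiv_conj_andreHodgeInvolution_tensor hY hZ hη hη', kunnethEquiv_conj_apply_kunnethCross,
    HasLefschetzProperty.andreHodgeInvolution_tensor_tmul _ _ _ _ (degreeOperator_tensor_ne_zero hY hZ hmn)
      (depth_degreeOperator_complexPoints_le hY) (depth_degreeOperator_complexPoints_le hZ)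
      (m := (i : ℤ) - m) (m' := (j : ℤ) - n) (by ring) (by ring)
      (ofDegree_mem_degreeSpace m i rfl a) (ofDegree_mem_degreeSpace n j rfl b), map_smul]

/-- **The printed form `*_H a × *_H b = (-1)^{ij} *_H (a × b)`** (`a ∈ Hⁱ(Y(ℂ))`, `b ∈ Hʲ(Z(ℂ))`, `m + n > 0`).
[cite: Andre1996Motifs, §1.3 Lemme 1.3.2 (p. 13)] -/
theorem andreHodgeInvolution_kunnethCross_symm (hmn : 0 < m + n) {i j : ℕ} (a : complexBetti Y i)
    (b : complexBetti Z j) :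
    haveI := finite_totalCohomology hY
    haveI := finite_totalCohomology hZ
    haveI := finite_totalCohomology (IsSmoothProjective.tensor_holds hY hZ)
    kunnethCross Y Z
          ((hasLefschetzProperty_complexPoints hY hη).andreHodgeInvolution (isZGrading_degreeOperator m) m
              (ofDegree ℂ (ComplexPoints Y) i a) ⊗ₜ
            (hasLefschetzProperty_complexPoints hZ hη').andreHodgeInvolution (isZGrading_degreeOperator n) n
              (ofDegree ℂ (ComplexPoints Z) j b)) =
      ((-1 : ℂ) ^ (i * j)) •
        (hasLefschetzProperty_complexPoints (IsSmoothProjective.tensor_holds hY hZ)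
            (hasHardLefschetzProperty_map_fst_add_map_snd hY hZ hη hη')).andreHodgeInvolution
            (isZGrading_degreeOperator (m + n)) (m + n)
          (kunnethCross Y Z (ofDegree ℂ (ComplexPoints Y) i a ⊗ₜ ofDegree ℂ (ComplexPoints Z) j b)) := by
  rw [andreHodgeInvolution_kunnethCross hY hZ hη hη' hmn a b, smul_smul, ← pow_add, ← two_mul, pow_mul, neg_one_sq,
    one_pow, one_smul]

end Hodge

end Literature.AlgebraicGeometry.HodgeTheory

end
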